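import Literature.Probability.Percolation.FourArmGarbanMonotone
import Literature.Probability.Percolation.InequalitiesProofs
import Mathlib.Analysis.SpecialFunctions.Pow.Real
import HarnessLib

/-!
# The five-arm event in cluster form and Reimer's step `π₄ ≥ π₅ / π₁` (bond percolation on `ℤ²`)

Topic `Literature/Probability/Percolation`. A bottom-up layer towards the named fact
`Kesten1987_zdKestenRelation` (`ZdNearCriticalWindow.lean`): the bond-`ℤ²` counterpart of the
tree's reduction `Werner2009_fourArm_lowerBound_of_fiveArm` (`ArmEventsReimer.lean`, site
percolation on `𝕋`) of the **a priori lower bound for four alternating arms**, `π₄(m,n) ≥ c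
(m/n)^{2-β}` (Werner 2009, Lecture 6, §3, third estimate: "derived from the five-arm estimate
and RSW"; Nolin 2008, proof of Cor. 36 [arXiv 0711.4948: Cor. 35]: "we use the a-priori bound
for `4` arms given by the `5`-arm exponent: `π₄(L',L) ≥ (L'/L)^{-α'} π₅(L',L) ≥ C (L'/L)^{2-α'}`"),
to the five-arm lower bound `π₅(m,n) ≥ c (m/n)²` (Nolin 2008, Thm. 24 (ii); Kesten 1987) and the
one-arm upper bound `π₁(m,n) ≤ C (m/n)^{α'}` (`ZdOneArmPowerBound.lean`), through Reimer's
inequality (`reimer_holds`, `InequalitiesProofs.lean`): `𝒜₅ ⊆ 𝒜₄ □ 𝒜₁`.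

* `zdFiveArmClusters m n` (DEFINITION) — the five-arm event `𝒜₅(A_{m,n})`, `σ₅ = (o c o c o)`
  (van den Berg–Nolin 2020, §1; Nolin 2008, §4.1), rendered in the duality-free CLUSTER FORM of
  `FourArmGarban.lean`: three open crossings of the square annulus `A_{m,n}` given by open
  lattice walks, the third edge-disjoint from the first two, the first two in distinct open
  clusters of the annulus (the two closed dual arms separating them are then automatic on the
  self-dual square lattice, and the two open arms not separated by a closed arm — here the first
  or second and the third — may belong to the same cluster, exactly as for `σ₅ = BWBBW`);
* `zdFiveArmClusters_subset_disjointOccurrence` — **`𝒜₅ ⊆ 𝒜₄ □ 𝒜₁`** with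
  `𝒜₄ = fourArmTwoClusters m n`, `𝒜₁ = sqAnnulusOpenCrossing m n` (witnesses: all pairs off the
  third walk for `𝒜₄`, the edges of the third walk for `𝒜₁`);
* `determinedBy_fourArmTwoClusters`, `isLocalEvent_fourArmTwoClusters`,
  `isLocalEvent_sqAnnulusOpenCrossing` — locality;
* `real_zdFiveArmClusters_le` — **Reimer: `P_p(𝒜₅) ≤ P_p(𝒜₄) · P_p(𝒜₁)`**, every `p`;
* `fourArm_lowerBound_of_fiveArm_oneArm` — the exponent bookkeeping: from
  `c₅ (m/n)² ≤ P_p(𝒜₅)` and `P_p(𝒜₁) ≤ C₁ (m/n)^α` one gets `(c₅/C₁) (m/n)^{2-α} ≤ P_p(𝒜₄)`.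

Deliberately NOT here: the five-arm lower bound itself (the lowest-crossing construction of
Nolin's Thm. 24 (ii) / Kesten–Sidoravicius–Zhang for bond percolation on `ℤ²`), which is the
remaining input of this reduction.
-/

noncomputable section

open MeasureTheory Set
open scoped unitInterval

namespace Literature.Probability.Percolation

open LatticeModels

/-- **The five-arm event `𝒜₅(A_{m,n})`, `σ₅ = (o c o c o)`, in cluster form** (van den Berg–Nolin
2020, §1, arm events `𝒜_σ(A_{n₁,n₂})`; Nolin 2008, §4.1, `σ₅ = BWBBW`; for bond percolation on
`ℤ²` in the duality-free rendering of `fourArmTwoClusters`, `FourArmGarban.lean`): there are three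
open lattice walks `W₁, W₂, W₃` inside the annulus `A_{m,n} = {m ≤ ‖·‖_∞ ≤ n}`, each from a
site of the sphere `‖·‖_∞ = m` to a site of the sphere `‖·‖_∞ = n`, the third one edge-disjoint
from the first two (three open arms, two of which may touch), and the inner endpoints of the
first two are NOT joined by an open path of the annulus (two distinct open annulus-clusters,
i.e. two closed dual arms separating them, whence the cyclic pattern open/closed/open/closed/open).
[cite: VandenbergNolin2020, §1 (arm events A_σ(A_{n₁,n₂}))] [cite: Nolin2008, §4.1 (colour sequences, σ₅) and §5.2 Thm. 24 (ii)] -/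
def zdFiveArmClusters (m n : ℕ) : Set (BondConfig (Site 2)) :=
  {ω | ∃ (x₁ x₂ x₃ y₁ y₂ y₃ : Site 2) (W₁ : (zdGraph 2).Walk x₁ y₁) (W₂ : (zdGraph 2).Walk x₂ y₂)
      (W₃ : (zdGraph 2).Walk x₃ y₃),
    x₁ ∈ siteSphere m ∧ x₂ ∈ siteSphere m ∧ x₃ ∈ siteSphere m ∧
    y₁ ∈ siteSphere n ∧ y₂ ∈ siteSphere n ∧ y₃ ∈ siteSphere n ∧
    (∀ z ∈ W₁.support, z ∈ sqAnnulus m n) ∧ (∀ z ∈ W₂.support, z ∈ sqAnnulus m n) ∧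
    (∀ z ∈ W₃.support, z ∈ sqAnnulus m n) ∧
    (∀ e ∈ W₁.edges, e ∈ ω) ∧ (∀ e ∈ W₂.edges, e ∈ ω) ∧ (∀ e ∈ W₃.edges, e ∈ ω) ∧
    (∀ e ∈ W₁.edges, e ∉ W₃.edges) ∧ (∀ e ∈ W₂.edges, e ∉ W₃.edges) ∧
    ω ∉ openConnIn (sqAnnulus m n) x₁ x₂}

/-- The five-arm event is contained in the four-arm event (forget the third arm). [folklore] -/
theorem zdFiveArmClusters_subset_fourArmTwoClusters (m n : ℕ) :
    zdFiveArmClusters m n ⊆ fourArmTwoClusters m n := by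
  rintro ω ⟨x₁, x₂, x₃, y₁, y₂, y₃, W₁, W₂, W₃, hx₁, hx₂, -, hy₁, hy₂, -, hs₁, hs₂, -, he₁, he₂, -,
    -, -, hsep⟩
  exact ⟨x₁, hx₁, x₂, hx₂, y₁, hy₁, y₂, hy₂, mem_openConnIn_of_walk W₁ hs₁ he₁,
    mem_openConnIn_of_walk W₂ hs₂ he₂, hsep⟩

/-- **`𝒜₅ ⊆ 𝒜₄ □ 𝒜₁`: the five-arm event is the disjoint occurrence of the four-arm event and
of a further open crossing** (the step "`π₅ ≤ π₄ · π₁` by Reimer's inequality" of Nolin 2008,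
proof of Cor. 36 [arXiv: Cor. 35], and of Werner 2009, Lecture 6, §3). Witnesses: the set `K` of
all pairs of sites other than the edges of the third walk (every configuration agreeing with `ω`
on `K` keeps `W₁`, `W₂` open and, being contained in `ω`, still separates their clusters) and the
set `L` of edges of the third walk (which keep `W₃` open). [cite: Nolin2008, §7.4, proof of Cor. 36 (arXiv 0711.4948: Cor. 35)] -/
theorem zdFiveArmClusters_subset_disjointOccurrence (m n : ℕ) :
    zdFiveArmClusters m n ⊆ fourArmTwoClusters m n □ sqAnnulusOpenCrossing m n := by
  rintro ω ⟨x₁, x₂, x₃, y₁, y₂, y₃, W₁, W₂, W₃, hx₁, hx₂, hx₃, hy₁, hy₂, hy₃, hs₁, hs₂, hs₃, he₁, he₂,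
    he₃, hd₁, hd₂, hsep⟩
  refine ⟨{e | e ∉ W₃.edges}, {e | e ∈ W₃.edges}, ?_, ?_, ?_⟩
  · exact Set.disjoint_left.2 fun e he he' => he he'
  · intro ω' hω'
    -- `ω' ⊆ ω`, and `ω'` agrees with `ω` on the edges of `W₁`, `W₂`
    have hsub : ω' ⊆ ω := fun e he => by
      by_cases h3 : e ∈ W₃.edges
      · exact he₃ e h3
      · exact (hω' e h3).1 he
    refine ⟨x₁, hx₁, x₂, hx₂, y₁, hy₁, y₂, hy₂,
      mem_openConnIn_of_walk W₁ hs₁ fun e he => (hω' e (hd₁ e he)).2 (he₁ e he),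
      mem_openConnIn_of_walk W₂ hs₂ fun e he => (hω' e (hd₂ e he)).2 (he₂ e he),
      fun hc => hsep (isUpperSet_openConnIn _ x₁ x₂ hsub hc)⟩
  · intro ω' hω'
    exact ⟨x₃, hx₃, y₃, hy₃, mem_openConnIn_of_walk W₃ hs₃ fun e he => (hω' e he).2 (he₃ e he)⟩

/-! ### Locality -/

/-- **The four-arm event depends only on the pairs of sites of the annulus.** [folklore] -/
theorem determinedBy_fourArmTwoClusters (m n : ℕ) :
    DeterminedBy (fourArmTwoClusters m n) ↑((annulus 2 (m - 1) n).sym2) := by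
  rw [determinedBy_iff]
  intro ω ω' h
  have hiff : ∀ x y : Site 2, (ω ∈ openConnIn (sqAnnulus m n) x y) = (ω' ∈ openConnIn (sqAnnulus m n) x y) :=
    fun x y => propext ((determinedBy_iff _ _).1
      (PlanarDuality.determinedBy_openConnIn (annulus 2 (m - 1) n) x y) ω ω' h)
  simp only [fourArmTwoClusters, mem_setOf_eq, hiff]

/-- The four-arm event is a local event. [folklore] -/
theorem isLocalEvent_fourArmTwoClusters (m n : ℕ) : IsLocalEvent (fourArmTwoClusters m n) :=
  ⟨_, determinedBy_fourArmTwoClusters m n⟩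

/-- The one-arm event is a local event. [folklore] -/
theorem isLocalEvent_sqAnnulusOpenCrossing (m n : ℕ) : IsLocalEvent (sqAnnulusOpenCrossing m n) := by
  have : sqAnnulusOpenCrossing m n =
      openCrossing (↑(annulus 2 (m - 1) n) : Set (Site 2)) ↑(siteSphere m) ↑(siteSphere n) := by
    ext ω
    simp only [sqAnnulusOpenCrossing, mem_openCrossing_iff, Finset.mem_coe, sqAnnulus, mem_setOf_eq]
  rw [this]
  exact isLocalEvent_openCrossing _ _ _

/-! ### Reimer's step -/

/-- **`P_p(𝒜₅(A_{m,n})) ≤ P_p(𝒜₄(A_{m,n})) · P_p(𝒜₁(A_{m,n}))`** for every `p` (Reimer's inequality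
`reimer_holds` applied to `𝒜₅ ⊆ 𝒜₄ □ 𝒜₁`; Nolin 2008, proof of Cor. 36 [arXiv: Cor. 35]: "we use
the a-priori bound for `4` arms given by the `5`-arm exponent: `π₄(L',L) ≥ (L'/L)^{-α'} π₅(L',L)`";
Werner 2009, Lecture 6, §3). [cite: Nolin2008, §7.4, proof of Cor. 36 (arXiv 0711.4948: Cor. 35)] [cite: ReimerCPC2000, main theorem] -/
theorem real_zdFiveArmClusters_le (p : unitInterval) (m n : ℕ) :
    (bondPercolation (zdGraph 2) p).real (zdFiveArmClusters m n) ≤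
      (bondPercolation (zdGraph 2) p).real (fourArmTwoClusters m n) *
        (bondPercolation (zdGraph 2) p).real (sqAnnulusOpenCrossing m n) :=
  (measureReal_mono (zdFiveArmClusters_subset_disjointOccurrence m n)).trans
    (reimer_holds (zdGraph 2) p (isLocalEvent_fourArmTwoClusters m n)
      (isLocalEvent_sqAnnulusOpenCrossing m n))

/-- **From the five-arm lower bound and the one-arm upper bound to the four-arm lower bound**
(Nolin 2008, proof of Cor. 36 [arXiv: Cor. 35]: `π₄ ≥ (L'/L)^{-α'} π₅ ≥ C (L'/L)^{2-α'}`; Werner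
2009, Lecture 6, §3, third a priori estimate): at a parameter `p` and radii `1 ≤ m ≤ n`, if
`c₅ (m/n)² ≤ P_p(𝒜₅(A_{m,n}))` and `P_p(𝒜₁(A_{m,n})) ≤ C₁ (m/n)^α` with `C₁ > 0`, then
`(c₅/C₁) (m/n)^{2-α} ≤ P_p(𝒜₄(A_{m,n}))`. [cite: Nolin2008, §7.4, proof of Cor. 36 (arXiv 0711.4948: Cor. 35)] [cite: WernerPCMI2009, Lecture 6, §3 (third a priori estimate)] -/
theorem fourArm_lowerBound_of_fiveArm_oneArm (p : unitInterval) {m n : ℕ} (hm : 1 ≤ m) (hmn : m ≤ n)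
    {c₅ C₁ α : ℝ} (hC₁ : 0 < C₁)
    (h5 : c₅ * ((m : ℝ) / n) ^ (2 : ℝ) ≤ (bondPercolation (zdGraph 2) p).real (zdFiveArmClusters m n))
    (h1 : (bondPercolation (zdGraph 2) p).real (sqAnnulusOpenCrossing m n) ≤ C₁ * ((m : ℝ) / n) ^ α) :
    c₅ / C₁ * ((m : ℝ) / n) ^ (2 - α) ≤ (bondPercolation (zdGraph 2) p).real (fourArmTwoClusters m n) := by
  set q : ℝ := (m : ℝ) / n with hq
  have hq0 : 0 < q := div_pos (by exact_mod_cast hm) (by exact_mod_cast (hm.trans hmn))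
  set P4 := (bondPercolation (zdGraph 2) p).real (fourArmTwoClusters m n) with hP4
  have hP4 : 0 ≤ P4 := measureReal_nonneg
  have hchain : c₅ * q ^ (2 : ℝ) ≤ P4 * (C₁ * q ^ α) :=
    h5.trans ((real_zdFiveArmClusters_le p m n).trans (mul_le_mul_of_nonneg_left h1 hP4))
  have hqα : 0 < q ^ α := Real.rpow_pos_of_pos hq0 α
  rw [Real.rpow_sub hq0, mul_div_assoc', div_le_iff₀ hqα, div_mul_eq_mul_div, div_le_iff₀ hC₁]
  linarith [hchain]

end Literature.Probability.Percolation
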